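import Mathlib
import Literature.NumberTheory.NumberFields.PureCubicClassNumberModThreeProofs
import Literature.NumberTheory.NumberFields.KummerCubeRootUnramified
import HarnessLib

/-!
# Ramification census for `L = ℚ(∛(pq), ζ₃) ⊇ F = ℚ(ζ₃)`, `pq ≡ 1 (mod 9)`

For distinct primes `p, q` with `pq ≡ 1 (mod 9)`, a sextic number field `L ∋ θ`, `θ³ = pq`, and a
subfield `F ⊆ L` with `[L:F] = 3` containing a primitive cube root of unity `ζ` (so `[F:ℚ] = 2`,
`F = ℚ(ζ₃)`, `L = F(θ)`): **a prime `𝔔` of `𝓞_L` ramified over `𝓞_F` contains `p` or `q`**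
(Dedekind's "second species": `λ = 1 − ζ₃` is unramified in `L/F`).

Proof, entirely through the relative different `𝔇 = 𝔇(𝓞_L/𝓞_F)`: a ramified `𝔔` divides `𝔇`
(Mathlib `dvd_differentIdeal_iff`), and `𝔇 ∋ g'(θ) = 3θ²` for `g = t³ − pq` since `L = F(θ)`
(Mathlib `aeval_derivative_mem_differentIdeal`, Neukirch III (2.4)); so `3 ∈ 𝔔` or `θ ∈ 𝔔 ∋ pq`.
If `3 ∈ 𝔔`, Hecke's integral generator `z = (θ − 1)/λ`, `λ = ζ − ζ² = √−3`, is a root of the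
monic `t³ − λt² − t − w` (`pq = 1 + 9m = 1 + λ³ · λm`) whose derivative at `z` is `≡ −1 (mod 𝔔)`,
contradicting `𝔇 ≤ 𝔔` (Hecke, *Lectures*, §39 Thm. 119, part II of the proof; the tree file
`Literature/NumberTheory/NumberFields/KummerCubeRootUnramified.lean` runs the same computation
under the extra hypothesis `(u) = 𝔞³`, which is only used away from `3`).
-/

set_option linter.dupNamespace false

noncomputable section

open Polynomial NumberField Ideal

open scoped Pointwise NumberField IntermediateField

namespace Summit.QuantumAdvantage.QuantumAdvantage.Theorems.LinnikCubicClassGroups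

open Literature.NumberTheory.NumberFields

variable {H E : Type*} [Field H] [NumberField H] [Field E] [NumberField E] [Algebra H E]

/-- **Hecke's generator at a prime above `3`.**  Let `H ⊆ E` be number fields, `λ, u, w ∈ 𝓞_H`
with `λ² = −3`, `u = 1 + λ³ w`, and `E = H(y)` with `y³ = u`.  Then no prime `𝔔 ∋ 3` of `𝓞_E`
contains the relative different `𝔇(𝓞_E/𝓞_H)`: `z = (y − 1)/λ ∈ 𝓞_E` generates `E/H` and is a
root of the monic `t³ − λt² − t − w`, whose derivative at `z` is `≡ −1 (mod 𝔔)`, while it lies in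
`𝔇` (Hecke, *Lectures on the Theory of Algebraic Numbers*, §39, proof of Thm. 119, part II;
Neukirch III (2.4)). [folklore] -/
theorem not_differentIdeal_le_of_three_mem {lam u w : 𝓞 H} (hlam : lam ^ 2 = -3)
    (hu : u = 1 + lam ^ 3 * w) {y : E} (hy : y ^ 3 = algebraMap (𝓞 H) E u)
    (hgen : IntermediateField.adjoin H {y} = ⊤) (Q : Ideal (𝓞 E)) [Q.IsPrime]
    (h3Q : (3 : 𝓞 E) ∈ Q) : ¬ differentIdeal (𝓞 H) (𝓞 E) ≤ Q := by
  -- adapted from Literature/NumberTheory/NumberFields/KummerCubeRootUnramified.lean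
  -- (`differentIdeal_eq_top_of_cube_root_one_mod_lambda_cubed`, the part at a prime above `3`)
  classical
  intro hDQ
  have hlam0 : lam ≠ 0 := by
    rintro rfl
    norm_num at hlam
  have hlamQ : algebraMap (𝓞 H) (𝓞 E) lam ∈ Q := algebraMap_lam_mem_of_three_mem hlam h3Q
  -- the Artin–Schreier generator `z = (y - 1)/λ`
  set lamE : E := algebraMap (𝓞 H) E lam with hlamE
  have hlamE0 : lamE ≠ 0 := by
    rw [hlamE, IsScalarTower.algebraMap_apply (𝓞 H) H E]
    exact (_root_.map_ne_zero _).mpr (RingOfIntegers.coe_ne_zero_iff.mpr hlam0)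
  have hlamE2 : lamE ^ 2 = -3 := by
    rw [hlamE, ← map_pow, hlam, map_neg, map_ofNat]
  have hyE : y ^ 3 = 1 + lamE ^ 3 * algebraMap (𝓞 H) E w := by
    rw [hy, hu, map_add, map_one, map_mul, map_pow]
  set z : E := (y - 1) / lamE with hzdef
  have hz : z ^ 3 - lamE * z ^ 2 - z - algebraMap (𝓞 H) E w = 0 :=
    artinSchreier_cubic_eq_zero hlamE2 hlamE0 hyE
  have hyz : y = 1 + lamE * z := by
    rw [hzdef, mul_div_cancel₀ _ hlamE0, add_sub_cancel]
  -- `z` is integral: a root of the monic `g = t³ − λt² − t − w`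
  set g : (𝓞 H)[X] := X ^ 3 - (C lam * X ^ 2 + X + C w) with hgdef
  have hgmonic : g.Monic := by
    refine (monic_X_pow 3).sub_of_left (lt_of_le_of_lt (degree_add_le _ _) (max_lt
      (lt_of_le_of_lt (degree_add_le _ _) (max_lt ?_ ?_)) ?_))
    · exact (degree_C_mul_X_pow_le 2 lam).trans_lt (by rw [degree_X_pow]; norm_num)
    · rw [degree_X, degree_X_pow]; norm_num
    · exact (degree_C_le).trans_lt (by rw [degree_X_pow]; norm_num)
  have hgz : aeval z g = 0 := by
    rw [hgdef]
    simp only [map_sub, map_add, map_mul, aeval_X_pow, aeval_C, aeval_X]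
    linear_combination hz
  have hzint : IsIntegral ℤ z := by
    have h1 : IsIntegral (𝓞 H) z := ⟨g, hgmonic, by rwa [← aeval_def]⟩
    exact isIntegral_trans z h1
  set Z : 𝓞 E := ⟨z, hzint⟩ with hZdef
  have hZE : algebraMap (𝓞 E) E Z = z := rfl
  -- `E = H(z)`
  have hyint : IsIntegral H y := by
    refine IsIntegral.of_pow (by norm_num : 0 < 3)
      ⟨Polynomial.X - Polynomial.C (algebraMap (𝓞 H) H u), monic_X_sub_C _, ?_⟩
    simp [hy, IsScalarTower.algebraMap_apply (𝓞 H) H E]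
  have hgen' : Algebra.adjoin H {algebraMap (𝓞 E) E Z} = ⊤ := by
    rw [hZE]
    have h1 : Algebra.adjoin H {y} = ⊤ := by
      rw [← IntermediateField.adjoin_simple_toSubalgebra_of_isAlgebraic hyint.isAlgebraic, hgen,
        IntermediateField.top_toSubalgebra]
    apply top_le_iff.mp
    rw [← h1]
    refine Algebra.adjoin_le (Set.singleton_subset_iff.mpr ?_)
    have hz_mem : z ∈ Algebra.adjoin H {z} := Algebra.subset_adjoin rfl
    have hlamH : lamE = algebraMap H E (lam : H) := IsScalarTower.algebraMap_apply (𝓞 H) H E lam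
    rw [SetLike.mem_coe, hyz, hlamH]
    exact Subalgebra.add_mem _ (Subalgebra.one_mem _)
      (Subalgebra.mul_mem _ (Subalgebra.algebraMap_mem _ _) hz_mem)
  -- `g'(Z) ∈ 𝔇`
  have hD := aeval_derivative_mem_differentIdeal (𝓞 H) H E Z hgen'
  have hZint : IsIntegral (𝓞 H) Z := Algebra.IsIntegral.isIntegral Z
  have hgZ : aeval Z g = 0 := by
    apply FaithfulSMul.algebraMap_injective (𝓞 E) E
    rw [← aeval_algebraMap_apply, hZE, hgz, map_zero]
  obtain ⟨h, hh⟩ := minpoly.isIntegrallyClosed_dvd hZint hgZ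
  have hgD : aeval Z (derivative g) ∈ differentIdeal (𝓞 H) (𝓞 E) := by
    have hder : aeval Z (derivative g) =
        aeval Z (derivative (minpoly (𝓞 H) Z)) * aeval Z h := by
      conv_lhs => rw [hh]
      rw [derivative_mul, map_add, map_mul, map_mul, minpoly.aeval, zero_mul, add_zero]
    rw [hder]
    exact Ideal.mul_mem_right _ _ hD
  -- but `g'(Z) = 3Z² − 2λZ − 1 ≡ −1 (mod Q)`
  have hval : aeval Z (derivative g) =
      3 * Z ^ 2 - algebraMap (𝓞 H) (𝓞 E) lam * (2 * Z) - 1 := by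
    rw [hgdef]
    simp only [derivative_X_pow, derivative_mul, derivative_C, derivative_X, zero_mul, zero_add,
      map_sub, map_add, map_mul, aeval_C, aeval_X_pow, Nat.cast_ofNat, map_one, map_zero, map_ofNat]
    ring
  have hmem : 3 * Z ^ 2 - algebraMap (𝓞 H) (𝓞 E) lam * (2 * Z) - 1 ∈ Q := hval ▸ hDQ hgD
  have hmem' : 3 * Z ^ 2 - algebraMap (𝓞 H) (𝓞 E) lam * (2 * Z) ∈ Q :=
    Q.sub_mem (Q.mul_mem_right _ h3Q) (Q.mul_mem_right _ hlamQ)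
  have hone : (1 : 𝓞 E) ∈ Q := by
    have := Q.sub_mem hmem' hmem
    rwa [sub_sub_cancel] at this
  exact ‹Q.IsPrime›.ne_top ((Ideal.eq_top_iff_one Q).mpr hone)

/-- **The derivative of `t³ − a` at a generating cube root lies in the different.**  For
`Θ ∈ 𝓞_E` with `Θ³ = a ∈ 𝓞_H` and `E = H(Θ)`, one has `3Θ² ∈ 𝔇(𝓞_E/𝓞_H)`: `g'(Θ) ∈ 𝔇` for the
minimal polynomial `g` of `Θ` over `𝓞_H` (Neukirch III (2.4); Mathlib
`aeval_derivative_mem_differentIdeal`), and `g ∣ t³ − a`. [folklore] -/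
theorem three_mul_sq_mem_differentIdeal {a : 𝓞 H} (Θ : 𝓞 E)
    (hΘ : Θ ^ 3 = algebraMap (𝓞 H) (𝓞 E) a)
    (hgen : IntermediateField.adjoin H {(Θ : E)} = ⊤) :
    3 * Θ ^ 2 ∈ differentIdeal (𝓞 H) (𝓞 E) := by
  classical
  set g : (𝓞 H)[X] := X ^ 3 - C a with hgdef
  have hgΘ : aeval Θ g = 0 := by
    simp [hgdef, hΘ]
  have hΘint : IsIntegral H (Θ : E) := .of_finite H _
  have hgen' : Algebra.adjoin H {algebraMap (𝓞 E) E Θ} = ⊤ := by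
    rw [← RingOfIntegers.coe_eq_algebraMap,
      ← IntermediateField.adjoin_simple_toSubalgebra_of_isAlgebraic hΘint.isAlgebraic, hgen,
      IntermediateField.top_toSubalgebra]
  have hD := aeval_derivative_mem_differentIdeal (𝓞 H) H E Θ hgen'
  have hZint : IsIntegral (𝓞 H) Θ := Algebra.IsIntegral.isIntegral Θ
  obtain ⟨h, hh⟩ := minpoly.isIntegrallyClosed_dvd hZint hgΘ
  have hder : aeval Θ (derivative g) = aeval Θ (derivative (minpoly (𝓞 H) Θ)) * aeval Θ h := by
    conv_lhs => rw [hh]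
    rw [derivative_mul, map_add, map_mul, map_mul, minpoly.aeval, zero_mul, add_zero]
  have hval : aeval Θ (derivative g) = 3 * Θ ^ 2 := by
    rw [hgdef]
    simp only [derivative_sub, derivative_X_pow, derivative_C, sub_zero, map_mul, aeval_X_pow,
      Nat.cast_ofNat, map_ofNat]
  rw [← hval, hder]
  exact Ideal.mul_mem_right _ _ hD

/-- **Ramification census (Dedekind's second species).**  For distinct primes `p, q` (`≠ 3`) with
`pq ≡ 1 (mod 9)`, a sextic number field `L ∋ θ`, `θ³ = pq`, and a subfield `F` with `[L:F] = 3`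
containing a primitive cube root of unity: every maximal ideal `𝔔` of `𝓞_L` with
`e(𝔔 | 𝔔 ∩ 𝓞_F) ≠ 1` contains `p` or `q`.  (A ramified `𝔔` divides the relative different
`𝔇 ∋ 3θ²`; if `θ ∈ 𝔔` then `pq ∈ 𝔔`; if `3 ∈ 𝔔`, Hecke's generator `(θ − 1)/(ζ − ζ²)`, available
because `pq ≡ 1 (mod 9) = (mod λ⁴)`, shows `𝔔 ∤ 𝔇`.) [folklore] -/
theorem stub_ramificationCensus :
    ∀ p q : ℕ, p.Prime → q.Prime → p ≠ 3 → q ≠ 3 → p ≠ q → (p * q) % 9 = 1 →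
    ∀ (L : Type) [Field L] [NumberField L] (F : IntermediateField ℚ L),
      Module.finrank ℚ L = 6 → Module.finrank F L = 3 →
      (∃ ζ : F, ζ ^ 3 = 1 ∧ ζ ≠ 1) → (∃ θ : L, θ ^ 3 = ((p * q : ℕ) : L)) →
      ∀ (Q : Ideal (𝓞 L)), Q.IsMaximal →
        Q.ramificationIdx (𝓞 F) ≠ 1 →
        ((p : 𝓞 L) ∈ Q ∨ (q : 𝓞 L) ∈ Q) := by
  intro p q hp hq _ _ hpq hpq9 L _ _ F hL6 hFL hζ hθ Q hQmax hram
  classical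
  obtain ⟨ζ, hζ3, hζ1⟩ := hζ
  obtain ⟨θ, hθ⟩ := hθ
  haveI := hQmax.isPrime
  by_contra hcon
  -- `𝔔` is ramified over `𝓞_F`, hence divides the relative different: `𝔇 ≤ 𝔔`
  have hunr : ¬ Algebra.IsUnramifiedAt (𝓞 F) Q := fun h =>
    hram (Ideal.ramificationIdx_eq_one_iff.mpr h)
  have hDQ : differentIdeal (𝓞 F) (𝓞 L) ≤ Q :=
    Ideal.dvd_iff_le.mp (dvd_differentIdeal_iff.mpr hunr)
  -- `θ ∈ 𝓞_L`
  have hθint : IsIntegral ℤ θ := by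
    refine ⟨X ^ 3 - C ((p * q : ℕ) : ℤ), monic_X_pow_sub_C _ (by norm_num), ?_⟩
    simp [hθ]
  set Θ : 𝓞 L := ⟨θ, hθint⟩ with hΘdef
  have hΘL : (Θ : L) = θ := rfl
  have hΘ3 : Θ ^ 3 = algebraMap (𝓞 F) (𝓞 L) ((p * q : ℕ) : 𝓞 F) := by
    rw [map_natCast]
    apply RingOfIntegers.coe_injective
    rw [map_pow, map_natCast, ← RingOfIntegers.coe_eq_algebraMap, hΘL, hθ]
  -- `[F:ℚ] = 2`, so `F` contains no cube root of `pq` and `L = F(θ)`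
  have hFdeg : Module.finrank ℚ F = 2 := by
    have h := Module.finrank_mul_finrank ℚ F L
    rw [hL6, hFL] at h
    omega
  have hnoroot : ∀ x : F, x ^ 3 ≠ ((p * q : ℕ) : F) := by
    intro x hx
    have hint : IsIntegral ℚ x := .of_finite ℚ x
    have h3 : Module.finrank ℚ ℚ⟮x⟯ = 3 := by
      rw [IntermediateField.adjoin.finrank hint, Honda1971.minpoly_eq hp hq hpq hx,
        natDegree_X_pow_sub_C]
    have h := Module.finrank_mul_finrank ℚ ℚ⟮x⟯ F
    rw [h3, hFdeg] at h
    omega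
  have hθF : IsIntegral F θ := .of_finite F θ
  have hdeg : (minpoly F θ).natDegree = 3 := by
    have hdvd : (minpoly F θ).natDegree ∣ 3 := by
      rw [← IntermediateField.adjoin.finrank hθF, ← hFL]
      exact Dvd.intro _ (Module.finrank_mul_finrank F (IntermediateField.adjoin F {θ}) L)
    have hne1 : (minpoly F θ).natDegree ≠ 1 := by
      rw [Ne, minpoly.natDegree_eq_one_iff]
      rintro ⟨x, hx⟩
      refine hnoroot x ?_
      apply (algebraMap F L).injective
      rw [map_pow, hx, hθ, map_natCast]
    rcases (Nat.dvd_prime Nat.prime_three).mp hdvd with h | h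
    · exact absurd h hne1
    · exact h
  have hgen : IntermediateField.adjoin F {θ} = ⊤ := by
    rw [Field.primitive_element_iff_minpoly_natDegree_eq, hdeg, hFL]
  -- `3θ² ∈ 𝔇 ≤ 𝔔`
  have h3Θ : 3 * Θ ^ 2 ∈ Q := hDQ (three_mul_sq_mem_differentIdeal Θ hΘ3 (hΘL ▸ hgen))
  rcases hQmax.isPrime.mem_or_mem h3Θ with h3 | hΘ2
  · -- `3 ∈ 𝔔`: Hecke's generator.  `ζ ∈ 𝓞_F`, `λ = ζ − ζ²`, `λ² = −3`
    have hζint : IsIntegral ℤ ζ :=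
      IsIntegral.of_pow (by norm_num : 0 < 3) (by rw [hζ3]; exact isIntegral_one)
    set ζO : 𝓞 F := ⟨ζ, hζint⟩ with hζOdef
    have hζOF : (ζO : F) = ζ := rfl
    have hζO3 : ζO ^ 3 = 1 := by
      apply RingOfIntegers.coe_injective
      rw [map_pow, map_one, ← RingOfIntegers.coe_eq_algebraMap, hζOF, hζ3]
    have hζO1 : ζO ≠ 1 := by
      intro h
      apply hζ1
      rw [← hζOF, h]
      rfl
    have hζO2 : ζO ^ 2 + ζO + 1 = 0 := by
      have h : (ζO - 1) * (ζO ^ 2 + ζO + 1) = 0 := by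
        linear_combination hζO3
      rcases mul_eq_zero.mp h with h | h
      · exact absurd (sub_eq_zero.mp h) hζO1
      · exact h
    set lam : 𝓞 F := ζO - ζO ^ 2 with hlamdef
    have hlam : lam ^ 2 = -3 := by
      rw [hlamdef]
      linear_combination (ζO - 2) * hζO3 + hζO2
    -- `pq = 1 + 9m = 1 + λ³ (λ m)`
    obtain ⟨m, hm⟩ : ∃ m : ℕ, p * q = 9 * m + 1 := by
      have key := Nat.div_add_mod (p * q) 9
      rw [hpq9] at key
      exact ⟨_, key.symm⟩
    have hu : ((p * q : ℕ) : 𝓞 F) = 1 + lam ^ 3 * (lam * m) := by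
      rw [hm]
      push_cast
      linear_combination (-(m : 𝓞 F) * (lam ^ 2 - 3)) * hlam
    have hy : θ ^ 3 = algebraMap (𝓞 F) L ((p * q : ℕ) : 𝓞 F) := by
      rw [map_natCast, hθ]
    exact not_differentIdeal_le_of_three_mem hlam hu hy hgen Q h3 hDQ
  · -- `θ ∈ 𝔔`, so `pq = θ³ ∈ 𝔔`
    have hΘQ : Θ ∈ Q := hQmax.isPrime.mem_of_pow_mem 2 hΘ2
    have hpqQ : (p : 𝓞 L) * (q : 𝓞 L) ∈ Q := by
      have h : Θ ^ 3 ∈ Q := Q.pow_mem_of_mem hΘQ 3 (by norm_num)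
      rwa [hΘ3, map_natCast, Nat.cast_mul] at h
    exact hcon (hQmax.isPrime.mem_or_mem hpqQ)

end Summit.QuantumAdvantage.QuantumAdvantage.Theorems.LinnikCubicClassGroups

end
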